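import Mathlib.RingTheory.TensorProduct.Basic
import HarnessLib

/-!
# Venture HSemireg — the three-slot tensor-trick homotopy and its FUNNEL (vanishing) rules

The algebraic skeleton of the «H-bookkeeping lemma» of `widen/W1/DEATHPATTERN-TOP10-w1cx2.md` §2
(computation cell `pub-hsemireg`, squad W1, second-code seat w1-cx-2; found independently as the
«FUNNEL» of `widen/W1/TOPEND-w1cx1.md` §2 by the sub-lead w1-cx-1).

Setting on paper (NOT in this file). Both W1 census codes evaluate transferred `A∞` products on
`A₀ = S × S × S` by the «tensor trick»: from a special deformation retract `(i, p, h)` of each slot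
(`h i = 0`, `p h = 0`, `h h = 0`, `p i = 1`; write `P = i p`, so that `h P = 0`, `P h = 0`,
`P P = P`) one forms on the triple tensor product the projector `Π = P ⊗ P ⊗ P` and the homotopy

  `H = h ⊗ 1 ⊗ 1 + P ⊗ h ⊗ 1 + P ⊗ P ⊗ h`

(with Koszul signs on paper; the signs are one `±1` per homogeneous summand and play no role in
the VANISHING statements below, which hold summand by summand). The lemma says which pure tensors
`H` kills outright: every summand of `H (z₁ ⊗ z₂ ⊗ z₃)` vanishes as soon as the first factor that
is not `h`-closed-and-`P`-fixed lies in `ker h ∩ ker P ⊇ im h` — this is what funnels every block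
adjacent to a «thin» letter `1 ⊗ 1 ⊗ x` into the single slot-3 condition `h (z₃ · x) = 0` of the
note, and it is the reason the one-letter kill of the note needs surface-kernel facts in ONE slot.

What is recorded here (ungraded `R`-modules ∕ `R`-algebras, no signs, no differential; PROOF-ONLY:
the operators are written out in every statement, on `(M₁ ⊗ M₂) ⊗ M₃`, with
`H = map (map h₁ 1) 1 + map (map P₁ h₂) 1 + map (map P₁ P₂) h₃` and `Π = map (map P₁ P₂) P₃`):

* `trH_tmul` — SHAPE rule (L1): `H (z₁ ⊗ z₂ ⊗ z₃) = h z₁ ⊗ z₂ ⊗ z₃ + P z₁ ⊗ h z₂ ⊗ z₃ + P z₁ ⊗ P z₂ ⊗ h z₃`;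
* `trH_tmul_of_ker₁`, `trH_tmul_of_ker₂`, `trH_tmul_of_kerh` — the FUNNEL (rule (L2)):
  `H (z₁ ⊗ z₂ ⊗ z₃) = 0` when `z₁ ∈ ker h ∩ ker P`, or `h z₁ = 0` and `z₂ ∈ ker h ∩ ker P`, or
  `h z₁ = h z₂ = h z₃ = 0`; `trH_tmul_fixed` — hence `H` kills pure tensors of `P`-images
  (`H ∘ (P ⊗ P ⊗ P) = 0` elementwise, given `h P = 0`);
* `trH_comp_trH`, `trP_comp_trH`, `trH_comp_trP`, `trP_comp_trP` — the tensor-trick side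
  conditions `H H = 0`, `Π H = 0`, `H Π = 0`, `Π Π = Π` from the slot side conditions
  (checked numerically as «K2» in the cell's `tensorB.py`);
* `h_ne_zero_of_exact` — the gauge-free half of the note's LAW ((7.7)–(7.8)): in ANY special
  deformation retract `1 = i p + d h + h d`, a non-zero cocycle `x` with `p x = 0` (e.g. a non-zero
  coboundary) has `h x ≠ 0` — so a thin letter whose neighbour feeds it a class it kills in
  cohomology is never dead;
* `trH_mul_thin_of_ker₁`, `trH_thin_mul_of_ker₁`, `trH_mul_thin_of_kerh₁₂` — for `R`-algebras:
  a block term `z₁ ⊗ z₂ ⊗ z₃` times a thin letter `1 ⊗ 1 ⊗ x` is killed by `H` identically when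
  `z₁ ∈ ker h ∩ ker P` (case (L3)(i) of the note), and when `h z₁ = h z₂ = 0` the only surviving
  summand is `P z₁ ⊗ P z₂ ⊗ h (z₃ x)` (cases (L3)(ii)/(iii) for the last slot: the block dies iff
  the slot-3 kernel fact `h (z₃ x) = 0` holds).

HONEST FRAMING. Linear algebra of three abstract modules with operators; the Lean index of a
bookkeeping lemma used in a MODEL-LEVEL mechanism analysis of one census cell of the cell's second
code. No complex, grading, sign, sheaf or abelian variety appears; nothing here says that HC, HC_CM
or HC_AV holds, and nothing here is a new case of anything.
-/

open scoped TensorProduct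

namespace Summit.Ventures.HSemireg

namespace TensorTrickFunnel

universe u v

section Modules

variable {R : Type u} [CommRing R] {M₁ M₂ M₃ : Type v}
  [AddCommGroup M₁] [Module R M₁] [AddCommGroup M₂] [Module R M₂] [AddCommGroup M₃] [Module R M₃]
  (h₁ P₁ : M₁ →ₗ[R] M₁) (h₂ P₂ : M₂ →ₗ[R] M₂) (h₃ P₃ : M₃ →ₗ[R] M₃)

/-- SHAPE rule (L1): on a pure tensor the tensor-trick homotopy
`H = h ⊗ 1 ⊗ 1 + P ⊗ h ⊗ 1 + P ⊗ P ⊗ h` produces the three summands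
`h z₁ ⊗ z₂ ⊗ z₃ + P z₁ ⊗ h z₂ ⊗ z₃ + P z₁ ⊗ P z₂ ⊗ h z₃`. -/
theorem trH_tmul (z₁ : M₁) (z₂ : M₂) (z₃ : M₃) :
    ((TensorProduct.map (TensorProduct.map h₁ LinearMap.id) LinearMap.id
        + TensorProduct.map (TensorProduct.map P₁ h₂) LinearMap.id
        + TensorProduct.map (TensorProduct.map P₁ P₂) h₃ : ((M₁ ⊗[R] M₂) ⊗[R] M₃ →ₗ[R] (M₁ ⊗[R] M₂) ⊗[R] M₃))) ((z₁ ⊗ₜ z₂) ⊗ₜ z₃)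
      = (h₁ z₁ ⊗ₜ z₂) ⊗ₜ z₃ + (P₁ z₁ ⊗ₜ h₂ z₂) ⊗ₜ z₃ + (P₁ z₁ ⊗ₜ P₂ z₂) ⊗ₜ h₃ z₃ := by
  simp [TensorProduct.map_tmul]

/-- The tensor-trick projector `Π = P ⊗ P ⊗ P` on a pure tensor. -/
theorem trP_tmul (z₁ : M₁) (z₂ : M₂) (z₃ : M₃) :
    (TensorProduct.map (TensorProduct.map P₁ P₂) P₃) ((z₁ ⊗ₜ z₂) ⊗ₜ z₃)
      = (P₁ z₁ ⊗ₜ P₂ z₂) ⊗ₜ P₃ z₃ := by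
  simp [TensorProduct.map_tmul]

/-- FUNNEL (L2), first slot: if `z₁ ∈ ker h ∩ ker P` (e.g. `z₁ ∈ im h` for a special deformation
retract), `H` kills `z₁ ⊗ z₂ ⊗ z₃` whatever `z₂`, `z₃` are. -/
theorem trH_tmul_of_ker₁ {z₁ : M₁} (hz₁ : h₁ z₁ = 0) (Pz₁ : P₁ z₁ = 0) (z₂ : M₂) (z₃ : M₃) :
    ((TensorProduct.map (TensorProduct.map h₁ LinearMap.id) LinearMap.id
        + TensorProduct.map (TensorProduct.map P₁ h₂) LinearMap.id
        + TensorProduct.map (TensorProduct.map P₁ P₂) h₃ : ((M₁ ⊗[R] M₂) ⊗[R] M₃ →ₗ[R] (M₁ ⊗[R] M₂) ⊗[R] M₃))) ((z₁ ⊗ₜ z₂) ⊗ₜ z₃) = 0 := by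
  simp [TensorProduct.map_tmul, hz₁, Pz₁]

/-- FUNNEL (L2), second slot: if `h z₁ = 0` and `z₂ ∈ ker h ∩ ker P`, `H` kills `z₁ ⊗ z₂ ⊗ z₃`. -/
theorem trH_tmul_of_ker₂ {z₁ : M₁} (hz₁ : h₁ z₁ = 0) {z₂ : M₂} (hz₂ : h₂ z₂ = 0) (Pz₂ : P₂ z₂ = 0)
    (z₃ : M₃) :
    ((TensorProduct.map (TensorProduct.map h₁ LinearMap.id) LinearMap.id
        + TensorProduct.map (TensorProduct.map P₁ h₂) LinearMap.id
        + TensorProduct.map (TensorProduct.map P₁ P₂) h₃ : ((M₁ ⊗[R] M₂) ⊗[R] M₃ →ₗ[R] (M₁ ⊗[R] M₂) ⊗[R] M₃))) ((z₁ ⊗ₜ z₂) ⊗ₜ z₃) = 0 := by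
  simp [TensorProduct.map_tmul, hz₁, hz₂, Pz₂]

/-- FUNNEL (L2), all slots `h`-closed: `H` kills `z₁ ⊗ z₂ ⊗ z₃` when `h z₁ = h z₂ = h z₃ = 0`. -/
theorem trH_tmul_of_kerh {z₁ : M₁} (hz₁ : h₁ z₁ = 0) {z₂ : M₂} (hz₂ : h₂ z₂ = 0) {z₃ : M₃}
    (hz₃ : h₃ z₃ = 0) :
    ((TensorProduct.map (TensorProduct.map h₁ LinearMap.id) LinearMap.id
        + TensorProduct.map (TensorProduct.map P₁ h₂) LinearMap.id
        + TensorProduct.map (TensorProduct.map P₁ P₂) h₃ : ((M₁ ⊗[R] M₂) ⊗[R] M₃ →ₗ[R] (M₁ ⊗[R] M₂) ⊗[R] M₃))) ((z₁ ⊗ₜ z₂) ⊗ₜ z₃) = 0 := by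
  simp [TensorProduct.map_tmul, hz₁, hz₂, hz₃]

/-- `H` kills every pure tensor of `P`-images when `h P = 0` in each slot
(`H ∘ I = 0` of the tensor-trick side conditions, elementwise). -/
theorem trH_tmul_fixed (hP₁ : h₁ ∘ₗ P₁ = 0) (hP₂ : h₂ ∘ₗ P₂ = 0) (hP₃ : h₃ ∘ₗ P₃ = 0)
    (z₁ : M₁) (z₂ : M₂) (z₃ : M₃) :
    ((TensorProduct.map (TensorProduct.map h₁ LinearMap.id) LinearMap.id
        + TensorProduct.map (TensorProduct.map P₁ h₂) LinearMap.id
        + TensorProduct.map (TensorProduct.map P₁ P₂) h₃ : ((M₁ ⊗[R] M₂) ⊗[R] M₃ →ₗ[R] (M₁ ⊗[R] M₂) ⊗[R] M₃))) ((P₁ z₁ ⊗ₜ P₂ z₂) ⊗ₜ P₃ z₃) = 0 :=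
  trH_tmul_of_kerh h₁ P₁ h₂ P₂ h₃
    (by simpa using LinearMap.congr_fun hP₁ z₁) (by simpa using LinearMap.congr_fun hP₂ z₂)
    (by simpa using LinearMap.congr_fun hP₃ z₃)

/-- Tensor-trick side condition `H H = 0`, from `h h = 0`, `h P = 0`, `P h = 0` in slots 1, 2
and `h h = 0` in slot 3. -/
theorem trH_comp_trH (hh₁ : h₁ ∘ₗ h₁ = 0) (hP₁ : h₁ ∘ₗ P₁ = 0) (Ph₁ : P₁ ∘ₗ h₁ = 0)
    (hh₂ : h₂ ∘ₗ h₂ = 0) (hP₂ : h₂ ∘ₗ P₂ = 0) (Ph₂ : P₂ ∘ₗ h₂ = 0) (hh₃ : h₃ ∘ₗ h₃ = 0) :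
    ((TensorProduct.map (TensorProduct.map h₁ LinearMap.id) LinearMap.id
        + TensorProduct.map (TensorProduct.map P₁ h₂) LinearMap.id
        + TensorProduct.map (TensorProduct.map P₁ P₂) h₃ : ((M₁ ⊗[R] M₂) ⊗[R] M₃ →ₗ[R] (M₁ ⊗[R] M₂) ⊗[R] M₃)))
      ∘ₗ ((TensorProduct.map (TensorProduct.map h₁ LinearMap.id) LinearMap.id
        + TensorProduct.map (TensorProduct.map P₁ h₂) LinearMap.id
        + TensorProduct.map (TensorProduct.map P₁ P₂) h₃ : ((M₁ ⊗[R] M₂) ⊗[R] M₃ →ₗ[R] (M₁ ⊗[R] M₂) ⊗[R] M₃))) = 0 := by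
  apply TensorProduct.ext_threefold
  intro z₁ z₂ z₃
  have e1 := LinearMap.congr_fun hh₁ z₁; have e2 := LinearMap.congr_fun hP₁ z₁
  have e3 := LinearMap.congr_fun Ph₁ z₁; have e4 := LinearMap.congr_fun hh₂ z₂
  have e5 := LinearMap.congr_fun hP₂ z₂; have e6 := LinearMap.congr_fun Ph₂ z₂
  have e7 := LinearMap.congr_fun hh₃ z₃
  simp only [LinearMap.coe_comp, Function.comp_apply, LinearMap.zero_apply] at e1 e2 e3 e4 e5 e6 e7
  simp [TensorProduct.map_tmul, map_add, e1, e2, e3, e4, e5, e6, e7]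

/-- Tensor-trick side condition `Π H = 0`, from `P h = 0` in every slot. -/
theorem trP_comp_trH (Ph₁ : P₁ ∘ₗ h₁ = 0) (Ph₂ : P₂ ∘ₗ h₂ = 0) (Ph₃ : P₃ ∘ₗ h₃ = 0) :
    TensorProduct.map (TensorProduct.map P₁ P₂) P₃
      ∘ₗ ((TensorProduct.map (TensorProduct.map h₁ LinearMap.id) LinearMap.id
        + TensorProduct.map (TensorProduct.map P₁ h₂) LinearMap.id
        + TensorProduct.map (TensorProduct.map P₁ P₂) h₃ : ((M₁ ⊗[R] M₂) ⊗[R] M₃ →ₗ[R] (M₁ ⊗[R] M₂) ⊗[R] M₃))) = 0 := by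
  apply TensorProduct.ext_threefold
  intro z₁ z₂ z₃
  have e1 := LinearMap.congr_fun Ph₁ z₁; have e2 := LinearMap.congr_fun Ph₂ z₂
  have e3 := LinearMap.congr_fun Ph₃ z₃
  simp only [LinearMap.coe_comp, Function.comp_apply, LinearMap.zero_apply] at e1 e2 e3
  simp [TensorProduct.map_tmul, map_add, e1, e2, e3]

/-- Tensor-trick side condition `H Π = 0`, from `h P = 0` in every slot. -/
theorem trH_comp_trP (hP₁ : h₁ ∘ₗ P₁ = 0) (hP₂ : h₂ ∘ₗ P₂ = 0) (hP₃ : h₃ ∘ₗ P₃ = 0) :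
    ((TensorProduct.map (TensorProduct.map h₁ LinearMap.id) LinearMap.id
        + TensorProduct.map (TensorProduct.map P₁ h₂) LinearMap.id
        + TensorProduct.map (TensorProduct.map P₁ P₂) h₃ : ((M₁ ⊗[R] M₂) ⊗[R] M₃ →ₗ[R] (M₁ ⊗[R] M₂) ⊗[R] M₃)))
      ∘ₗ TensorProduct.map (TensorProduct.map P₁ P₂) P₃ = 0 := by
  apply TensorProduct.ext_threefold
  intro z₁ z₂ z₃
  have e1 := LinearMap.congr_fun hP₁ z₁; have e2 := LinearMap.congr_fun hP₂ z₂
  have e3 := LinearMap.congr_fun hP₃ z₃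
  simp only [LinearMap.coe_comp, Function.comp_apply, LinearMap.zero_apply] at e1 e2 e3
  simp [TensorProduct.map_tmul, e1, e2, e3]

/-- Tensor-trick side condition `Π Π = Π`, from `P P = P` in every slot. -/
theorem trP_comp_trP (PP₁ : P₁ ∘ₗ P₁ = P₁) (PP₂ : P₂ ∘ₗ P₂ = P₂) (PP₃ : P₃ ∘ₗ P₃ = P₃) :
    TensorProduct.map (TensorProduct.map P₁ P₂) P₃ ∘ₗ TensorProduct.map (TensorProduct.map P₁ P₂) P₃
      = TensorProduct.map (TensorProduct.map P₁ P₂) P₃ := by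
  apply TensorProduct.ext_threefold
  intro z₁ z₂ z₃
  have e1 := LinearMap.congr_fun PP₁ z₁; have e2 := LinearMap.congr_fun PP₂ z₂
  have e3 := LinearMap.congr_fun PP₃ z₃
  simp only [LinearMap.coe_comp, Function.comp_apply] at e1 e2 e3
  simp [TensorProduct.map_tmul, e1, e2, e3]

end Modules

section OneSlot

/-! ### One slot: `h` detects the cocycles that `p` does not see (gauge-free) -/

variable {R : Type u} [CommRing R] {M : Type v} [AddCommGroup M] [Module R M]
  (d h P : M →ₗ[R] M)

/-- In a deformation retract written with the projector `P = i p` — `x = P x + d (h x) + h (d x)`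
for all `x` — a cocycle (`d x = 0`) invisible to the projection (`P x = 0`) is the boundary of
`h x`; in particular it is zero as soon as `h x = 0`. -/
theorem eq_d_h_of_cocycle (hsdr : ∀ x, x = P x + d (h x) + h (d x)) {x : M} (hdx : d x = 0)
    (hPx : P x = 0) : x = d (h x) := by
  have e := hsdr x
  rw [hdx, map_zero, hPx, zero_add, add_zero] at e
  exact e

/-- Gauge-free half of the LAW of `DEATHPATTERN-TOP10-w1cx2.md` (7.7)–(7.8): a NON-ZERO cocycle with
`P x = 0` (e.g. the product of a thin section with a class it kills in cohomology, which is a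
non-zero coboundary) has `h x ≠ 0`, whatever the homotopy `h` is. -/
theorem h_ne_zero_of_exact (hsdr : ∀ x, x = P x + d (h x) + h (d x)) {x : M} (hdx : d x = 0)
    (hPx : P x = 0) (hx : x ≠ 0) : h x ≠ 0 := by
  intro hzero
  apply hx
  rw [eq_d_h_of_cocycle d h P hsdr hdx hPx, hzero, map_zero]

end OneSlot

section Algebras

/-! ### The thin letter (cases (L3)(i)–(iii) of the note), for algebras -/

variable {R : Type u} [CommRing R] {A₁ A₂ A₃ : Type v}
  [Ring A₁] [Algebra R A₁] [Ring A₂] [Algebra R A₂] [Ring A₃] [Algebra R A₃]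
  (h₁ P₁ : A₁ →ₗ[R] A₁) (h₂ P₂ : A₂ →ₗ[R] A₂) (h₃ P₃ : A₃ →ₗ[R] A₃)

/-- (L3)(i): a block term whose FIRST factor lies in `ker h ∩ ker P`, multiplied on the right by a
thin slot-3 letter `1 ⊗ 1 ⊗ x`, is killed by `H` identically — no condition on `x`. -/
theorem trH_mul_thin_of_ker₁ {z₁ : A₁} (hz₁ : h₁ z₁ = 0) (Pz₁ : P₁ z₁ = 0) (z₂ : A₂)
    (z₃ x : A₃) :
    ((TensorProduct.map (TensorProduct.map h₁ LinearMap.id) LinearMap.id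
        + TensorProduct.map (TensorProduct.map P₁ h₂) LinearMap.id
        + TensorProduct.map (TensorProduct.map P₁ P₂) h₃ : ((A₁ ⊗[R] A₂) ⊗[R] A₃ →ₗ[R] (A₁ ⊗[R] A₂) ⊗[R] A₃)))
      (((z₁ ⊗ₜ[R] z₂) ⊗ₜ[R] z₃) * ((1 ⊗ₜ[R] 1) ⊗ₜ[R] x)) = 0 := by
  rw [Algebra.TensorProduct.tmul_mul_tmul, Algebra.TensorProduct.tmul_mul_tmul, mul_one, mul_one]
  exact trH_tmul_of_ker₁ h₁ P₁ h₂ P₂ h₃ hz₁ Pz₁ z₂ (z₃ * x)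

/-- (L3)(i), thin letter on the LEFT. -/
theorem trH_thin_mul_of_ker₁ {z₁ : A₁} (hz₁ : h₁ z₁ = 0) (Pz₁ : P₁ z₁ = 0) (z₂ : A₂)
    (z₃ x : A₃) :
    ((TensorProduct.map (TensorProduct.map h₁ LinearMap.id) LinearMap.id
        + TensorProduct.map (TensorProduct.map P₁ h₂) LinearMap.id
        + TensorProduct.map (TensorProduct.map P₁ P₂) h₃ : ((A₁ ⊗[R] A₂) ⊗[R] A₃ →ₗ[R] (A₁ ⊗[R] A₂) ⊗[R] A₃)))
      (((1 ⊗ₜ[R] 1) ⊗ₜ[R] x) * ((z₁ ⊗ₜ[R] z₂) ⊗ₜ[R] z₃)) = 0 := by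
  rw [Algebra.TensorProduct.tmul_mul_tmul, Algebra.TensorProduct.tmul_mul_tmul, one_mul, one_mul]
  exact trH_tmul_of_ker₁ h₁ P₁ h₂ P₂ h₃ hz₁ Pz₁ z₂ (x * z₃)

/-- (L3)(ii)/(iii) for the last slot: against a block term with `h`-closed first two factors, a
thin slot-3 letter `1 ⊗ 1 ⊗ x` leaves exactly ONE summand of `H`, namely `P z₁ ⊗ P z₂ ⊗ h (z₃ x)`
— so that block dies iff the slot-3 kernel fact `h (z₃ x) = 0` holds. -/
theorem trH_mul_thin_of_kerh₁₂ {z₁ : A₁} (hz₁ : h₁ z₁ = 0) {z₂ : A₂} (hz₂ : h₂ z₂ = 0)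
    (z₃ x : A₃) :
    ((TensorProduct.map (TensorProduct.map h₁ LinearMap.id) LinearMap.id
        + TensorProduct.map (TensorProduct.map P₁ h₂) LinearMap.id
        + TensorProduct.map (TensorProduct.map P₁ P₂) h₃ : ((A₁ ⊗[R] A₂) ⊗[R] A₃ →ₗ[R] (A₁ ⊗[R] A₂) ⊗[R] A₃)))
      (((z₁ ⊗ₜ[R] z₂) ⊗ₜ[R] z₃) * ((1 ⊗ₜ[R] 1) ⊗ₜ[R] x))
      = (P₁ z₁ ⊗ₜ P₂ z₂) ⊗ₜ h₃ (z₃ * x) := by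
  rw [Algebra.TensorProduct.tmul_mul_tmul, Algebra.TensorProduct.tmul_mul_tmul, mul_one, mul_one,
    trH_tmul, hz₁, hz₂]
  simp

end Algebras

end TensorTrickFunnel

end Summit.Ventures.HSemireg
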